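import Summits.BirchSwinnertonDyer.BirchSwinnertonDyer.Theorems.ThetaPartnerAtTwoSignedControlAtTwoPlusDivOfPrint
import HarnessLib

/-!
# Non-primitive COINV♯ at `2`: `(Sel♯_{S₀}(E/ℚ_∞))_Γ = 0` for Kobayashi's `S₀`-non-primitive plus Selmer group, from the four
# printed Greenberg facts and `Sel_{2^∞}(E/ℚ)` finite — and the level-`Γ_ℚ` lift «LIFT′♯» feeding it

Route `ThetaPartnerAtTwo` (TP2), crux K1 `SignedTransportAtTwo` (stmt-BirchSwinnertonDyer-20333), line `bridge` v23; the object is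
the non-primitive signed Selmer group of that line,
`Sel♯_{S₀} = unramifiedOutside (ker κ) E[2^∞] 2 S₀ ⊓ ⨅_{v ∋ 2} ⨅_σ conj_σ⁻¹(localKummerOverOfEmb W 2 (ker κ) (closureEmb ℚ_v) (⨆ₙ E⁺ₙ))`
(no condition at the odd places `v ∈ S₀`, Kobayashi's plus condition at `2`, unramified elsewhere). Seat `prover-bsd-wall-tp2-p3-w2` (K4
width seat 2/3, g3), serving K1's research stub `stub_surj2` (GV Prop. (2.1) at `2`): this file is the «`I_Γ = 0`» input of the engine
`…SignedTransportAtTwoSurjEngine`.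

WHAT IS PROVED (`W/ℚ` globally minimal, `GoodSS W 2`, `a₂(W) = 0`, `κ` cyclotomic, `γ` a topological generator, `S₀` a finite set of
places containing the bad ones):
* §1 `plusLocKummer_two_of_localPlus` — LOC⁺@2 for a class `t` that is `Γ_ℚ`-invariant modulo the PLUS LOCAL CONDITION ONLY (not modulo
  `Sel⁺_∞`): the engine `exists_localLift_kummerOfEmb` (width seat w2/w3) fed by `PlusLayer.plusHondaSystemTwo_adicCompletion` (p592468)
  and `plusCoinvPair_two_of_honda` — adapted from w3's `plusLocKummer_two_of_honda`;
* §2 `exists_sub_resOfLe_mem_sharp_of_cassels` — LIFT′♯: granted Cassels' surjectivity (PUB) and `Sel_{2^∞}(W/ℚ)` finite, every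
  `t ∈ H¹(ℚ_Σ/ℚ_∞, E[2^∞])` which is `Γ_ℚ`-invariant modulo `Sel♯_{S₀}` is congruent modulo `Sel♯_{S₀}` to a restricted class `res y`;
  only the place above `2` needs a local lift (no condition at `v ∈ S₀`);
* §3 `sharp_forall_exists_conjH1_sub_eq_of_print4` — COINV♯: granted PUB⁴ and `Sel_{2^∞}(W/ℚ)` finite, every `s ∈ Sel♯_{S₀}` is
  `conj_γ s' − s'` with `s' ∈ Sel♯_{S₀}` («DIV in `H¹(ℚ_Σ/ℚ_∞, E[2^∞])`» from Prop. 4.12 + weak Leopoldt + the corank count, as in width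
  seat 2's door, then §2).

HONEST FRAMING: THEOREMS ONLY (no definition, no named fact, no `sorry`); conditional on PRINTED-but-unproved facts of Greenberg
LNM 1716 / Cassels / Kato taken as hypotheses; closes no item; BSD is not proved by any of this.

References: [GreenbergLNM1716] §4 pp. 104, 107–109 (Lemma 4.7), Props. 4.12–4.13, pp. 119–122, §5 p. 140; [GreenbergVatsal2000] §2
Props. (2.1), (2.5); [BDKim2013] Props. 2.2–2.3, Thm. 3.14; [Kobayashi2003] Def. 1.1, §8.4; [Kato2004Asterisque] Thm. 12.4.
-/

set_option autoImplicit false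
-- the Theorems namespace of this sub repeats the summit name by design (D-0017 nested layout)
set_option linter.dupNamespace false

noncomputable section

open scoped Classical NumberField

open NumberField IsDedekindDomain

namespace Summit.BirchSwinnertonDyer.BirchSwinnertonDyer.Theorems.SignedEC

open Literature.NumberTheory.EllipticCurves Literature.NumberTheory.GaloisRepresentations
  WeierstrassCurve ZpExtension Literature.NumberTheory.EllipticCurves.Kobayashi2003
  Literature.NumberTheory.EllipticCurves.IwasawaDual Literature.NumberTheory.EllipticCurves.IwasawaAlgebra
  Literature.NumberTheory.EllipticCurves.GreenbergVatsal2000 Literature.NumberTheory.EllipticCurves.Rank1Residual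
  Literature.NumberTheory.EllipticCurves.Sprung2012 Summit.BirchSwinnertonDyer.Rank1Residual.Additive

variable (W : WeierstrassCurve ℚ) [W.IsElliptic] [W.IsGloballyMinimal]

/-! ## §1. LOC⁺@2 for a class invariant modulo the plus local condition only -/

/-- **LOC⁺@2, local form.** As `plusLocKummer_two`, but the class `t ∈ H¹(ℚ_∞, E[2^∞])` is only assumed `Γ_ℚ`-invariant modulo
the plus LOCAL Kummer condition at the place `w ∋ 2` (the hypothesis the engine `exists_localLift_kummerOfEmb` really uses); the plus
Honda system is `PlusLayer.plusHondaSystemTwo_adicCompletion`. Adapted from `plusLocKummer_two_of_honda` (width seat 3).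
[cite: GreenbergLNM1716, §4 proof of Lemma 4.7 (p. 108)] [cite: Kobayashi2003, §8.4, Thm. 6.2] [cite: BDKim2013, Props. 2.2–2.3] -/
theorem plusLocKummer_two_of_localPlus (hss : GoodSS W 2) (ha : W.frobeniusTrace 2 = 0) {κ : ZpExtension ℚ 2}
    (hκ : κ.IsCyclotomic) (t : W.subgroupH1 2 κ.kerSubgroup) (w : HeightOneSpectrum (𝓞 ℚ))
    (hw : ((2 : ℕ) : 𝓞 ℚ) ∈ w.asIdeal)
    (ht : ∀ σ : Field.absoluteGaloisGroup ℚ, W.conjH1 2 κ.kerSubgroup σ t - t ∈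
      localKummerOverOfEmb W 2 κ.kerSubgroup (closureEmb (K := ℚ) (w.adicCompletion ℚ))
        (⨆ n, signedLocalPoints κ (w.adicCompletion ℚ) W 1 n)) :
    ∃ xw : discreteH1 (localSubgroup (⊤ : Subgroup (Field.absoluteGaloisGroup ℚ)) (w.adicCompletion ℚ))
        (localPoints W (w.adicCompletion ℚ)),
      (∃ k : ℕ, 2 ^ k • xw = 0) ∧
      ∀ y : W.subgroupH1 2 (⊤ : Subgroup (Field.absoluteGaloisGroup ℚ)),
        W.localResOver 2 ⊤ (w.adicCompletion ℚ) y = xw →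
        t - W.resOfLe 2 (le_top : κ.kerSubgroup ≤ ⊤) y ∈
          localKummerOverOfEmb W 2 κ.kerSubgroup (closureEmb (K := ℚ) (w.adicCompletion ℚ))
            (⨆ n, signedLocalPoints κ (w.adicCompletion ℚ) W 1 n) := by
  -- adapted from `plusLocKummer_two_of_honda` (…PlusLocKummerOfHonda, width seat 3)
  have hw' : (2 : 𝓞 ℚ) ∈ w.asIdeal := by exact_mod_cast hw
  obtain ⟨g, hg⟩ := hκ.exists_isTopGenerator_resGalOfEmb_adicCompletion w hw'
  obtain ⟨d, hd, htr, hgen, hgen0⟩ := PlusLayer.plusHondaSystemTwo_adicCompletion W hss ha κ hκ w hw'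
  have hnt : ∀ P ∈ localTowerPointsOfEmb κ (closureEmb (K := ℚ) (w.adicCompletion ℚ)) W, 2 • P = 0 → P = 0 :=
    fun P hP h2 ↦ SSFlatEC.eq_zero_of_mem_localTowerPointsOfEmb_of_two_nsmul W hss κ hw' _ hP h2
  refine @exists_localLift_kummerOfEmb ℚ _ _ W _ 2 _ κ (w.adicCompletion ℚ) _
    (charZero_of_injective_algebraMap (algebraMap ℚ (w.adicCompletion ℚ)).injective) _ g hg hnt
    (⨆ n, signedLocalPoints κ (w.adicCompletion ℚ) W 1 n)
    (iSup_signedLocalPointsOfEmb_le_localTowerPointsOfEmb W κ 1 (closureEmb (K := ℚ) (w.adicCompletion ℚ)))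
    ((localLayerPointsOfEmb_zero_le_signedLocalPointsOfEmb κ _ W 1 0).trans
      (le_iSup (fun n ↦ signedLocalPoints κ (w.adicCompletion ℚ) W 1 n) 0))
    (fun σ a ha ↦ ?_) (fun x hx k ↦ ?_) t (ht _)
  swap
  · obtain ⟨x', hx', m, hm, e⟩ := plusCoinvPair_two_of_honda W hss hκ w hw' hg d hd htr hgen hgen0 x hx k
    exact ⟨x', hx', m, iSup_signedLocalPointsOfEmb_le_localTowerPointsOfEmb W κ 1
      (closureEmb (K := ℚ) (w.adicCompletion ℚ)) hm, e⟩
  -- `Γ_{ℚ_w}`-stability of `⨆ₙ E⁺_n`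
  refine AddSubgroup.iSup_induction (fun n ↦ signedLocalPoints κ (w.adicCompletion ℚ) W 1 n)
    (C := fun a ↦ σ • a ∈ ⨆ n, signedLocalPoints κ (w.adicCompletion ℚ) W 1 n) ha ?_ ?_ ?_
  · intro n a ha
    refine le_iSup (fun n ↦ signedLocalPoints κ (w.adicCompletion ℚ) W 1 n) n ?_
    have ha' : a ∈ signedLocalPointsOfEmb κ (closureEmb (K := ℚ) (w.adicCompletion ℚ)) W 1 n := ha
    show σ • a ∈ signedLocalPointsOfEmb κ (closureEmb (K := ℚ) (w.adicCompletion ℚ)) W 1 n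
    rw [signedLocalPointsOfEmb_eq_towerSigned] at ha' ⊢
    exact smul_mem_towerSignedLocalPointsOfEmb κ.layerSubgroup _ W 1 n σ ha'
  · rw [smul_zero]; exact AddSubgroup.zero_mem _
  · intro a b ha hb; rw [smul_add]; exact AddSubgroup.add_mem _ ha hb

/-! ## §2. LIFT′♯: the level-`Γ_ℚ` lift for classes invariant modulo `Sel♯_{S₀}` -/

omit [W.IsElliptic] [W.IsGloballyMinimal] in
/-- Membership in the plus part of `Sel♯_{S₀}` unpacked at one place and one conjugation. [folklore] -/
theorem mem_localKummer_of_mem_iInf {κ : ZpExtension ℚ 2} {x : W.subgroupH1 2 κ.kerSubgroup}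
    (hx : x ∈ ⨅ (v : HeightOneSpectrum (𝓞 ℚ)) (_ : ((2 : ℕ) : 𝓞 ℚ) ∈ v.asIdeal) (σ : Field.absoluteGaloisGroup ℚ),
      (localKummerOverOfEmb W 2 κ.kerSubgroup (closureEmb (K := ℚ) (v.adicCompletion ℚ))
        (⨆ n : ℕ, signedLocalPoints κ (v.adicCompletion ℚ) W 1 n)).comap (W.conjH1 2 κ.kerSubgroup σ))
    (w : HeightOneSpectrum (𝓞 ℚ)) (hw : ((2 : ℕ) : 𝓞 ℚ) ∈ w.asIdeal) (σ : Field.absoluteGaloisGroup ℚ) :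
    W.conjH1 2 κ.kerSubgroup σ x ∈ localKummerOverOfEmb W 2 κ.kerSubgroup (closureEmb (K := ℚ) (w.adicCompletion ℚ))
      (⨆ n : ℕ, signedLocalPoints κ (w.adicCompletion ℚ) W 1 n) := by
  have h1 := (AddSubgroup.mem_iInf.mp hx) w
  have h2 := (AddSubgroup.mem_iInf.mp h1) hw
  have h3 := (AddSubgroup.mem_iInf.mp h2) σ
  exact AddSubgroup.mem_comap.mp h3

/-- **LIFT′♯ (Greenberg's Lemma 4.7 assembly for `Sel♯_{S₀}`).** `W/ℚ` globally minimal, `GoodSS W 2`, `a₂(W) = 0`, `κ` cyclotomic,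
`S₀ ⊇` the bad places; granted CASSELS at level `Γ_ℚ` (PUB `casselsSurjectivity_H1Sigma ℚ`) and `Sel_{2^∞}(W/ℚ)` finite: every
`t ∈ H¹(ℚ_Σ/ℚ_∞, E[2^∞])` with `conj_σ t − t ∈ Sel♯_{S₀}` for all `σ` satisfies `t − res y ∈ Sel♯_{S₀}` for some `y ∈ H¹(Γ_ℚ, E[2^∞])`
— a local lift is needed ONLY above `2` (§1); at `v ∈ S₀` there is no condition, and `E(ℚ)[2] = 0` on the row
(`P2.irr_two_of_goodSS_two`). [cite: GreenbergLNM1716, §4 Lemma 4.7 (pp. 107–108), p. 122 (Cassels)] [cite: GreenbergVatsal2000, §2 p. 23] -/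
theorem exists_sub_resOfLe_mem_sharp_of_cassels (hC : Greenberg1999.casselsSurjectivity_H1Sigma ℚ)
    (hss : GoodSS W 2) (ha : W.frobeniusTrace 2 = 0) {κ : ZpExtension ℚ 2} (hκ : κ.IsCyclotomic)
    (S₀ : Finset (HeightOneSpectrum (𝓞 ℚ))) (hS : ∀ v : HeightOneSpectrum (𝓞 ℚ), ¬ W.HasGoodReductionAt v → v ∈ S₀)
    (hSel : Finite (W.selmerGroupPInfty 2)) {t : W.subgroupH1 2 κ.kerSubgroup}
    (htH : t ∈ unramifiedOutside κ.kerSubgroup (W.geomPrimaryTorsion 2) 2 (↑S₀ : Set (HeightOneSpectrum (𝓞 ℚ))))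
    (ht : ∀ σ : Field.absoluteGaloisGroup ℚ, W.conjH1 2 κ.kerSubgroup σ t - t ∈
      unramifiedOutside κ.kerSubgroup ↥(W.geomPrimaryTorsion 2) 2 (↑S₀ : Set (HeightOneSpectrum (𝓞 ℚ))) ⊓
        ⨅ (v : HeightOneSpectrum (𝓞 ℚ)) (_ : ((2 : ℕ) : 𝓞 ℚ) ∈ v.asIdeal) (σ : Field.absoluteGaloisGroup ℚ),
          (localKummerOverOfEmb W 2 κ.kerSubgroup (closureEmb (K := ℚ) (v.adicCompletion ℚ))
            (⨆ n : ℕ, signedLocalPoints κ (v.adicCompletion ℚ) W 1 n)).comap (W.conjH1 2 κ.kerSubgroup σ)) :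
    ∃ y : W.subgroupH1 2 (⊤ : Subgroup (Field.absoluteGaloisGroup ℚ)),
      t - W.resOfLe 2 (le_top : κ.kerSubgroup ≤ ⊤) y ∈
        unramifiedOutside κ.kerSubgroup ↥(W.geomPrimaryTorsion 2) 2 (↑S₀ : Set (HeightOneSpectrum (𝓞 ℚ))) ⊓
          ⨅ (v : HeightOneSpectrum (𝓞 ℚ)) (_ : ((2 : ℕ) : 𝓞 ℚ) ∈ v.asIdeal) (σ : Field.absoluteGaloisGroup ℚ),
            (localKummerOverOfEmb W 2 κ.kerSubgroup (closureEmb (K := ℚ) (v.adicCompletion ℚ))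
              (⨆ n : ℕ, signedLocalPoints κ (v.adicCompletion ℚ) W 1 n)).comap (W.conjH1 2 κ.kerSubgroup σ) := by
  -- `E(ℚ)[2] = 0` at good supersingular `2`: `#E(ℚ)[2^∞] = 1`
  have hirr := (Summit.BirchSwinnertonDyer.Rank1Residual.X5.O1.irr_two_iff_forall_two_nsmul W).mp
    (Summit.BirchSwinnertonDyer.Rank1Residual.P2.irr_two_of_goodSS_two W hss)
  have hE : Nat.card (MulAction.fixedPoints (Field.absoluteGaloisGroup ℚ) (W.geomPrimaryTorsion 2)) = 1 := by
    refine W.natCard_fixedPoints_absoluteGaloisGroup_geomPrimaryTorsion_eq_one (p := 2) fun P hP ↦ ?_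
    apply hirr P
    convert hP
  have hgood : ∀ v : HeightOneSpectrum (𝓞 ℚ), v ∉ (↑S₀ : Set (HeightOneSpectrum (𝓞 ℚ))) →
      ((2 : ℕ) : 𝓞 ℚ) ∉ v.asIdeal → W.HasGoodReductionAt v := by
    intro v hv _
    by_contra hng
    exact hv (Finset.mem_coe.mpr (hS v hng))
  -- the plus local lifts above `2`
  have hloc : ∀ w : HeightOneSpectrum (𝓞 ℚ), ((2 : ℕ) : 𝓞 ℚ) ∈ w.asIdeal →
      ∃ xw : discreteH1 (localSubgroup (⊤ : Subgroup (Field.absoluteGaloisGroup ℚ)) (w.adicCompletion ℚ))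
          (localPoints W (w.adicCompletion ℚ)),
        (∃ k : ℕ, 2 ^ k • xw = 0) ∧
        ∀ y : W.subgroupH1 2 (⊤ : Subgroup (Field.absoluteGaloisGroup ℚ)),
          W.localResOver 2 ⊤ (w.adicCompletion ℚ) y = xw →
          t - W.resOfLe 2 (le_top : κ.kerSubgroup ≤ ⊤) y ∈
            localKummerOverOfEmb W 2 κ.kerSubgroup (closureEmb (K := ℚ) (w.adicCompletion ℚ))
              (⨆ n, signedLocalPoints κ (w.adicCompletion ℚ) W 1 n) := fun w hw ↦
    plusLocKummer_two_of_localPlus W hss ha hκ t w hw fun σ ↦ by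
      have h := mem_localKummer_of_mem_iInf W (ht σ).2 w hw 1
      rwa [W.conjH1_one_holds 2 κ.kerSubgroup, AddMonoidHom.id_apply] at h
  -- the local classes to prescribe
  let x : ∀ v : HeightOneSpectrum (𝓞 ℚ),
      discreteH1 (localSubgroup (⊤ : Subgroup (Field.absoluteGaloisGroup ℚ)) (v.adicCompletion ℚ))
        (localPoints W (v.adicCompletion ℚ)) := fun v ↦
    if h : ((2 : ℕ) : 𝓞 ℚ) ∈ v.asIdeal then Classical.choose (hloc v h) else 0
  have hx_of : ∀ v (h : ((2 : ℕ) : 𝓞 ℚ) ∈ v.asIdeal), x v = Classical.choose (hloc v h) := fun v h ↦ dif_pos h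
  have hx_tor : ∀ v, ∃ k : ℕ, 2 ^ k • x v = 0 := fun v ↦ by
    by_cases h : ((2 : ℕ) : 𝓞 ℚ) ∈ v.asIdeal
    · rw [hx_of v h]; exact (Classical.choose_spec (hloc v h)).1
    · rw [show x v = 0 from dif_neg h]; exact ⟨0, smul_zero _⟩
  let xi : ∀ w : InfinitePlace ℚ,
      discreteH1 (localSubgroup (⊤ : Subgroup (Field.absoluteGaloisGroup ℚ)) w.Completion)
        (localPoints W w.Completion) := fun _ ↦ 0
  obtain ⟨y, hyH, hyfin, -⟩ := hC W 2 hSel hE (↑S₀ : Set (HeightOneSpectrum (𝓞 ℚ))) S₀.finite_toSet hgood x xi hx_tor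
    (fun _ ↦ ⟨0, smul_zero _⟩)
  refine ⟨y, ?_, ?_⟩
  · -- unramified outside `S₀ ∪ {2}`
    exact AddSubgroup.sub_mem _ htH
      (SSFlatEC.resOfLe_mem_unramifiedOutside (W.geomPrimaryTorsion 2) (le_top : κ.kerSubgroup ≤ ⊤) 2 _ hyH)
  · -- the plus condition above `2`, for every conjugate
    refine AddSubgroup.mem_iInf.mpr fun w ↦ AddSubgroup.mem_iInf.mpr fun hw ↦ AddSubgroup.mem_iInf.mpr fun σ ↦ ?_
    rw [AddSubgroup.mem_comap]
    have hsplit : W.conjH1 2 κ.kerSubgroup σ (t - W.resOfLe 2 (le_top : κ.kerSubgroup ≤ ⊤) y) =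
        (W.conjH1 2 κ.kerSubgroup σ t - t) + (t - W.resOfLe 2 (le_top : κ.kerSubgroup ≤ ⊤) y) := by
      rw [map_sub, SSFlatEC.conjH1_resOfLe_top W κ σ y]; abel
    rw [hsplit]
    refine AddSubgroup.add_mem _ ?_ ?_
    · have h := mem_localKummer_of_mem_iInf W (ht σ).2 w hw 1
      rwa [W.conjH1_one_holds 2 κ.kerSubgroup, AddMonoidHom.id_apply] at h
    · exact (Classical.choose_spec (hloc w hw)).2 y (by rw [hyfin w (Or.inr hw), hx_of w hw])

/-! ## §3. COINV♯ from the four printed facts -/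

omit [W.IsElliptic] [W.IsGloballyMinimal] in
/-- `Sel♯_{S₀}` is `Γ_ℚ`-stable (both of its defining conditions are). [folklore] -/
theorem conjH1_mem_sharp {κ : ZpExtension ℚ 2} (S₀ : Finset (HeightOneSpectrum (𝓞 ℚ)))
    (σ : Field.absoluteGaloisGroup ℚ) {s : W.subgroupH1 2 κ.kerSubgroup}
    (hs : s ∈ unramifiedOutside κ.kerSubgroup ↥(W.geomPrimaryTorsion 2) 2 (↑S₀ : Set (HeightOneSpectrum (𝓞 ℚ))) ⊓
        ⨅ (v : HeightOneSpectrum (𝓞 ℚ)) (_ : ((2 : ℕ) : 𝓞 ℚ) ∈ v.asIdeal) (σ : Field.absoluteGaloisGroup ℚ),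
          (localKummerOverOfEmb W 2 κ.kerSubgroup (closureEmb (K := ℚ) (v.adicCompletion ℚ))
            (⨆ n : ℕ, signedLocalPoints κ (v.adicCompletion ℚ) W 1 n)).comap (W.conjH1 2 κ.kerSubgroup σ)) :
    W.conjH1 2 κ.kerSubgroup σ s ∈
      unramifiedOutside κ.kerSubgroup ↥(W.geomPrimaryTorsion 2) 2 (↑S₀ : Set (HeightOneSpectrum (𝓞 ℚ))) ⊓
        ⨅ (v : HeightOneSpectrum (𝓞 ℚ)) (_ : ((2 : ℕ) : 𝓞 ℚ) ∈ v.asIdeal) (σ : Field.absoluteGaloisGroup ℚ),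
          (localKummerOverOfEmb W 2 κ.kerSubgroup (closureEmb (K := ℚ) (v.adicCompletion ℚ))
            (⨆ n : ℕ, signedLocalPoints κ (v.adicCompletion ℚ) W 1 n)).comap (W.conjH1 2 κ.kerSubgroup σ) := by
  refine ⟨conjH1_mem_unramifiedOutside κ.kerSubgroup (W.geomPrimaryTorsion 2) 2 _ σ hs.1, ?_⟩
  refine AddSubgroup.mem_iInf.mpr fun w ↦ AddSubgroup.mem_iInf.mpr fun hw ↦ AddSubgroup.mem_iInf.mpr fun τ ↦ ?_
  rw [AddSubgroup.mem_comap, ← AddMonoidHom.comp_apply, ← W.conjH1_mul_holds 2 κ.kerSubgroup]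
  exact mem_localKummer_of_mem_iInf W hs.2 w hw (τ * σ)

/-- **COINV♯ — `(Sel♯_{S₀}(E/ℚ_∞))_Γ = 0` from the four printed facts.** `W/ℚ` globally minimal, `GoodSS W 2`, `a₂(W) = 0`, `κ`
cyclotomic with topological generator `γ`, `S₀ ⊇` the bad places, `Sel_{2^∞}(W/ℚ)` finite; granted PUB⁴ by name
(`casselsSurjectivity_H1Sigma ℚ`, `prop412_noFiniteSubmodule_H1Sigma_of_rank_one`, `h1Sigma_zpCorank_le_degree ℚ`,
`h1SigmaInfty_rank_eq_one`): every `s ∈ Sel♯_{S₀}` is `conj_γ s' − s'` for some `s' ∈ Sel♯_{S₀}`. Greenberg's p. 119 argument: DIV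
in `H = H¹(ℚ_Σ/ℚ_∞, E[2^∞])` (dual finitely generated by `finite_dual_H1Sigma_holds`, rank `1`, no finite submodule, `Y[T]` finite),
then LIFT′♯ (§2) and `conj_γ(res y) = res y`. [cite: GreenbergLNM1716, §4 p. 104, p. 119, Props. 4.12–4.13]
[cite: GreenbergVatsal2000, §2 Prop. (2.5)] [cite: Kato2004Asterisque, Thm. 12.4] -/
theorem sharp_forall_exists_conjH1_sub_eq_of_print4 (hC : Greenberg1999.casselsSurjectivity_H1Sigma ℚ)
    (h412 : Greenberg1999.prop412_noFiniteSubmodule_H1Sigma_of_rank_one)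
    (hcork : Greenberg1999.h1Sigma_zpCorank_le_degree ℚ) (hWL : Greenberg1999.h1SigmaInfty_rank_eq_one)
    (hss : GoodSS W 2) (ha : W.frobeniusTrace 2 = 0) {κ : ZpExtension ℚ 2} (hκ : κ.IsCyclotomic)
    {γ : Field.absoluteGaloisGroup ℚ} (hγ : κ.IsTopGenerator γ)
    (S₀ : Finset (HeightOneSpectrum (𝓞 ℚ))) (hS : ∀ v : HeightOneSpectrum (𝓞 ℚ), ¬ W.HasGoodReductionAt v → v ∈ S₀)
    (hSel : Finite (W.selmerGroupPInfty 2)) :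
    ∀ s ∈ unramifiedOutside κ.kerSubgroup ↥(W.geomPrimaryTorsion 2) 2 (↑S₀ : Set (HeightOneSpectrum (𝓞 ℚ))) ⊓
        ⨅ (v : HeightOneSpectrum (𝓞 ℚ)) (_ : ((2 : ℕ) : 𝓞 ℚ) ∈ v.asIdeal) (σ : Field.absoluteGaloisGroup ℚ),
          (localKummerOverOfEmb W 2 κ.kerSubgroup (closureEmb (K := ℚ) (v.adicCompletion ℚ))
            (⨆ n : ℕ, signedLocalPoints κ (v.adicCompletion ℚ) W 1 n)).comap (W.conjH1 2 κ.kerSubgroup σ),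
      ∃ s' ∈ unramifiedOutside κ.kerSubgroup ↥(W.geomPrimaryTorsion 2) 2 (↑S₀ : Set (HeightOneSpectrum (𝓞 ℚ))) ⊓
        ⨅ (v : HeightOneSpectrum (𝓞 ℚ)) (_ : ((2 : ℕ) : 𝓞 ℚ) ∈ v.asIdeal) (σ : Field.absoluteGaloisGroup ℚ),
          (localKummerOverOfEmb W 2 κ.kerSubgroup (closureEmb (K := ℚ) (v.adicCompletion ℚ))
            (⨆ n : ℕ, signedLocalPoints κ (v.adicCompletion ℚ) W 1 n)).comap (W.conjH1 2 κ.kerSubgroup σ),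
        W.conjH1 2 κ.kerSubgroup γ s' - s' = s := by
  intro s hs
  have hgood : ∀ v : HeightOneSpectrum (𝓞 ℚ), v ∉ S₀ → ((2 : ℕ) : 𝓞 ℚ) ∉ v.asIdeal → W.HasGoodReductionAt v := by
    intro v hv _
    by_contra hng
    exact hv (hS v hng)
  have hgood' : ∀ v : HeightOneSpectrum (𝓞 ℚ), v ∉ (↑S₀ : Set (HeightOneSpectrum (𝓞 ℚ))) →
      ((2 : ℕ) : 𝓞 ℚ) ∉ v.asIdeal → W.HasGoodReductionAt v :=
    fun v hv hpv ↦ hgood v (fun h ↦ hv (Finset.mem_coe.mpr h)) hpv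
  -- the dual datum of `H¹(ℚ_Σ/ℚ_∞, E[2^∞])` (tree theorem), (a) by Prop. 4.12 + weak Leopoldt, (b) by the corank count
  obtain ⟨Y, _instY₁, _instY₂, _instY₃, dY, hbij, hT, hCY⟩ :=
    Greenberg1999.finite_dual_H1Sigma_holds W 2 κ γ hκ hγ S₀ hgood
  have hrank : Module.rank (IwasawaAlgebra 2) Y = 1 := hWL W 2 κ γ hκ hγ S₀ hgood Y dY hbij hT hCY
  have hY : ∀ N : Submodule (IwasawaAlgebra 2) Y, Finite N → N = ⊥ :=
    h412 W 2 κ γ hκ hγ S₀ hgood Y dY hbij hT hCY hrank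
  have hco : coinvariantsRank 2 Y ≤ 1 := by
    rw [SSFlatEC.coinvariantsRank_eq_zpCorank_unramifiedOutside_top W κ hγ S₀.finite_toSet dY hbij hT hCY]
    have h := hcork W 2 hSel (↑S₀ : Set (HeightOneSpectrum (𝓞 ℚ))) S₀.finite_toSet hgood'
    rwa [Module.finrank_self] at h
  have hfin : Finite (invariants 2 Y) :=
    IwasawaAlgebra.finite_invariants_of_rank_eq_one_of_coinvariantsRank_le_one 2 hrank hco
  -- DIV in `H`
  obtain ⟨t, htH, hts⟩ := SSFlatEC.forall_exists_conjH1_sub_eq_of_noFinite_of_finite W κ hγ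
    (unramifiedOutside κ.kerSubgroup (W.geomPrimaryTorsion 2) 2 (↑S₀ : Set (HeightOneSpectrum (𝓞 ℚ))))
    (fun x hx ↦ conjH1_mem_unramifiedOutside κ.kerSubgroup (W.geomPrimaryTorsion 2) 2 _ γ hx)
    dY hbij hT hCY hY hfin s hs.1
  -- `t` is `Γ_ℚ`-invariant modulo `Sel♯_{S₀}`
  have htall := SSFlatEC.conjH1_sub_mem_of_conjH1_generator_sub_mem W κ hγ _
    (fun σ x hx ↦ conjH1_mem_sharp W S₀ σ hx) (by rw [hts]; exact hs)
  -- LIFT′♯ and the conclusion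
  obtain ⟨y, hy⟩ := exists_sub_resOfLe_mem_sharp_of_cassels W hC hss ha hκ S₀ hS hSel htH htall
  refine ⟨t - W.resOfLe 2 (le_top : κ.kerSubgroup ≤ ⊤) y, hy, ?_⟩
  rw [map_sub, SSFlatEC.conjH1_resOfLe_top W κ γ y, ← hts]
  abel

end Summit.BirchSwinnertonDyer.BirchSwinnertonDyer.Theorems.SignedEC

end
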